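import Literature.AlgebraicTopology.SingularHomology.RelativeMayerVietoris
import Literature.AlgebraicTopology.SingularHomology.OpenCoverHomologyMayerVietoris
import Mathlib.Algebra.Homology.HomologySequenceLemmas
import HarnessLib

/-!
# The relative Mayer–Vietoris sequence `H(U ∩ V, A) → H(U, A) ⊕ H(V, A) → H(U ∪ V, A)` for open
# `U`, `V` containing a common subspace `A`

A. Hatcher, *Algebraic Topology* (2002), §2.2, p. 152: "There is also a relative form of the
Mayer–Vietoris sequence … for a pair `(X, Y) = (A ∪ B, C ∪ D)` with `C ⊂ A` and `D ⊂ B`", obtained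
from the short exact sequence of quotient complexes
`0 → Cₙ(A ∩ B, C ∩ D) → Cₙ(A, C) ⊕ Cₙ(B, D) → Cₙ(A + B, C + D) → 0` and the small-chains
isomorphisms (Prop. 2.21; "the five-lemma" for the quotients, p. 152). This file proves the case of
a COMMON subspace `C = D` (written `A` below; the case needed for the pairs `(U, U ∖ S)`, `S` a
fixed closed set, after the excision `Hₙ(U, U ∖ S) ≅ Hₙ(U ∪ (X ∖ S), X ∖ S)`), in the tree's
concrete model: for `A ⊆ X` and `W ⊇ A`, the relative chains of `W` modulo `A` are the image
`π(C(W)) ⊆ C(X)/C(A)` (`relOpenMV.relSub`, an instance of `Subcomplex.mapπ`,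
`RelativeMayerVietoris.lean`), and for `U`, `V` open with `A ⊆ U`:

* `Subcomplex.mapπSES`, `mapπSES_shortExact` — `0 → 𝒜 → S → π(S) → 0` for subcomplexes `𝒜 ≤ S`;
  `Subcomplex.isIso_homologyMap_incl_mapπ` — **quotients of quasi-isomorphic subcomplexes are
  quasi-isomorphic**: if `S ≤ T` (both `≥ 𝒜`) induces isomorphisms `H(S) ≅ H(T)`, so does
  `π(S) ≤ π(T)` (Hatcher's five-lemma step, via Mathlib's `isIso_homologyMap_τ₃`);
* `relOpenMV.isIso_homologyMap_incl_relSub_sup` — the relative small-chains isomorphism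
  `H(π(C(U)) + π(C(V))) ≅ H(π(C(U ∪ V)))`;
* `relOpenMV.hIn : H_q(U ∩ V, A) → H_q(U, A) × H_q(V, A)` (`x ↦ (x, x)`),
  `relOpenMV.hDiff : H_q(U, A) × H_q(V, A) → H_q(U ∪ V, A)` (`(y, z) ↦ y - z`),
  `relOpenMV.hδ : H_{q+1}(U ∪ V, A) → H_q(U ∩ V, A)`, and **exactness at the three spots**
  (`relOpenMV.h_exact₂`, `h_exact₃`, `h_exact₁`), all on the homology of the complexes
  `(relSub A W).toComplex`; `hDiff_surjective_of_isZero` (and `…_of_subsingleton`) — the consequence used for generation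
  statements: `H_{q+1}(U, A) × H_{q+1}(V, A) → H_{q+1}(U ∪ V, A)` is onto when `H_q(U ∩ V, A) = 0`.

The proofs are those of the absolute case (`OpenCoverHomologyMayerVietoris.lean`, Hatcher p. 149)
run inside `C(X)/C(A)`: `π(C(U) ⊓ C(V)) = π(C(U)) ⊓ π(C(V))` because `C(A) ≤ C(U)`
(`Subcomplex.mapπ_inf`), `π(C(U) ⊔ C(V)) = π(C(U)) ⊔ π(C(V))` (`mapπ_sup`), and the tree's short
exact sequence `Subcomplex.mvSub` of the two subcomplexes `π(C(U))`, `π(C(V))`.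
Everything is proved; no named facts.

## References

* [HatcherAT2002] A. Hatcher, Algebraic Topology, CUP 2002, §2.2 pp. 149–152 (Mayer–Vietoris,
  relative form), Prop. 2.21 (small chains).
-/

noncomputable section

-- as in `SingularChainsConcrete` / `LocalHomology`: chains of the concrete complex are `Finsupp`s
-- up to unfolding of semireducible definitions
set_option backward.isDefEq.respectTransparency false

open CategoryTheory Limits

universe u v w t

namespace Literature.AlgebraicTopology.SingularHomology

/-! ### Quotients of quasi-isomorphic subcomplexes by a common subcomplex -/

namespace Subcomplex

variable {R : Type v} [CommRing R]
variable {β : Type t} {c : ComplexShape β} {K : HomologicalComplex (ModuleCat.{w} R) c}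

/-- `toMapπ` kills `𝒜`: `incl ≫ toMapπ = 0` for `𝒜 ≤ S`. [folklore] -/
@[reassoc]
lemma incl_comp_toMapπ {𝒜 S : Subcomplex K} (h : 𝒜 ≤ S) : incl h ≫ toMapπ 𝒜 S = 0 := by
  ext i x
  simp only [HomologicalComplex.comp_f, ModuleCat.hom_comp, LinearMap.comp_apply,
    HomologicalComplex.zero_f, ModuleCat.hom_zero, LinearMap.zero_apply]
  exact (toMapπ_f_eq_zero_iff 𝒜 S i _).2 (by rw [incl_f_apply_val]; exact x.2)

/-- **The short exact sequence `0 → 𝒜 → S → π(S) → 0`** of a subcomplex `S ⊇ 𝒜` and its image in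
`K/𝒜` (Hatcher 2002, §2.1–2.2: `0 → C(C) → C(A) → C(A, C) → 0`). [cite: HatcherAT2002, §2.2 p. 152] -/
def mapπSES (𝒜 S : Subcomplex K) (h : 𝒜 ≤ S) : ShortComplex (HomologicalComplex (ModuleCat.{w} R) c) :=
  ShortComplex.mk (incl h) (toMapπ 𝒜 S) (incl_comp_toMapπ h)

/-- `0 → 𝒜 → S → π(S) → 0` is short exact. [cite: HatcherAT2002, §2.2 p. 152] -/
theorem mapπSES_shortExact (𝒜 S : Subcomplex K) (h : 𝒜 ≤ S) : (mapπSES 𝒜 S h).ShortExact := by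
  refine HomologicalComplex.shortExact_of_degreewise_shortExact _ (fun i => ?_)
  refine ModuleCat.shortComplex_shortExact _ ?_ (incl_f_injective h i) (toMapπ_f_surjective 𝒜 S i)
  change Function.Exact ((incl h).f i) ((toMapπ 𝒜 S).f i)
  intro y
  rw [toMapπ_f_eq_zero_iff]
  constructor
  · intro hy
    exact ⟨⟨y.1, hy⟩, Subtype.ext rfl⟩
  · rintro ⟨x, rfl⟩
    rw [incl_f_apply_val]
    exact x.2

/-- The morphism of short exact sequences `(0 → 𝒜 → S → π(S) → 0) ⟶ (0 → 𝒜 → T → π(T) → 0)` for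
`𝒜 ≤ S ≤ T` (identity on `𝒜`, inclusions elsewhere). [folklore] -/
def mapπSESMap (𝒜 S T : Subcomplex K) (h : 𝒜 ≤ S) (hST : S ≤ T) :
    mapπSES 𝒜 S h ⟶ mapπSES 𝒜 T (h.trans hST) where
  τ₁ := 𝟙 _
  τ₂ := incl hST
  τ₃ := incl (mapπ_mono 𝒜 hST)
  comm₁₂ := by
    change incl h ≫ incl hST = 𝟙 _ ≫ incl (h.trans hST)
    rw [incl_comp_incl, Category.id_comp]
  comm₂₃ := by
    change toMapπ 𝒜 S ≫ incl (mapπ_mono 𝒜 hST) = incl hST ≫ toMapπ 𝒜 T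
    rw [incl_toMapπ]

/-- **Quotients of quasi-isomorphic subcomplexes by a common subcomplex are quasi-isomorphic**
(Hatcher 2002, §2.2 p. 152, the five-lemma step of the relative Mayer–Vietoris sequence / of
excision for pairs): if `𝒜 ≤ S ≤ T` and `S ↪ T` induces isomorphisms on homology in all degrees,
then so does `π(S) ↪ π(T)` in `K/𝒜`. [cite: HatcherAT2002, §2.2 p. 152] -/
theorem isIso_homologyMap_incl_mapπ {𝒜 S T : Subcomplex K} (h : 𝒜 ≤ S) (hST : S ≤ T)
    (hiso : ∀ j, IsIso (HomologicalComplex.homologyMap (incl hST) j)) (i : β) :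
    IsIso (HomologicalComplex.homologyMap (incl (mapπ_mono 𝒜 hST)) i) := by
  have key := HomologicalComplex.HomologySequence.isIso_homologyMap_τ₃ (mapπSESMap 𝒜 S T h hST)
    (mapπSES_shortExact 𝒜 S h) (mapπSES_shortExact 𝒜 T (h.trans hST)) i
    (by change Epi (HomologicalComplex.homologyMap (𝟙 _) i); infer_instance)
    (by change IsIso (HomologicalComplex.homologyMap (incl hST) i); exact hiso i)
    (fun j _ => by change IsIso (HomologicalComplex.homologyMap (𝟙 _) j); infer_instance)
    (fun j _ => by
      change Mono (HomologicalComplex.homologyMap (incl hST) j)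
      haveI := hiso j
      infer_instance)
  exact key

/-- Transport of homology along an equality of subcomplexes. [folklore] -/
def homologyIsoOfEq {S T : Subcomplex K} (h : S = T) (i : β) :
    S.toComplex.homology i ≅ T.toComplex.homology i :=
  haveI := Subcomplex.isIso_incl_of_eq h
  (HomologicalComplex.homologyFunctor _ _ i).mapIso (asIso (incl h.le))

/-- `homologyIsoOfEq` unfolded. [folklore] -/
lemma homologyIsoOfEq_hom {S T : Subcomplex K} (h : S = T) (i : β) :
    (homologyIsoOfEq h i).hom = HomologicalComplex.homologyMap (incl h.le) i := rfl

end Subcomplex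

/-! ### The relative Mayer–Vietoris sequence in the concrete model -/

namespace relOpenMV

variable (R : Type v) [CommRing R] (M : Type v) [AddCommGroup M] [Module R M]
variable {X : Type u} [TopologicalSpace X] (A : Set X)

/-- **The relative chains of `W` modulo `A`**, `π(C(W)) ⊆ C(X)/C(A)`: for `A ⊆ W` this is
`C(W)/C(A) = C(W, A)` (Hatcher 2002, §2.1–2.2), embedded in `C(X)/C(A)`.
[cite: HatcherAT2002, §2.2 p. 152] -/
abbrev relSub (W : Set X) : Subcomplex (chainsInSub R M X A).quotient :=
  Subcomplex.mapπ (chainsInSub R M X A) (chainsInSub R M X W)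

variable {A}

/-- `relSub` is monotone in `W`. [folklore] -/
lemma relSub_mono {W W' : Set X} (h : W ⊆ W') : relSub R M A W ≤ relSub R M A W' :=
  Subcomplex.mapπ_mono _ (chainsInSub_mono R M h)

/-- `π(C(U ∩ V)) = π(C(U)) ⊓ π(C(V))` when `A ⊆ U`. [cite: HatcherAT2002, §2.2 p. 152] -/
lemma relSub_inter {U : Set X} (hA : A ⊆ U) (V : Set X) :
    relSub R M A (U ∩ V) = relSub R M A U ⊓ relSub R M A V := by
  change Subcomplex.mapπ _ (chainsInSub R M X (U ∩ V)) = _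
  rw [chainsInSub_inter, Subcomplex.mapπ_inf (chainsInSub_mono R M hA)]

/-- `π(C(U)) ⊔ π(C(V)) = π(C(U) + C(V))`. [cite: HatcherAT2002, §2.2 p. 152] -/
lemma relSub_sup (U V : Set X) :
    relSub R M A U ⊔ relSub R M A V =
      Subcomplex.mapπ (chainsInSub R M X A) (chainsInSub R M X U ⊔ chainsInSub R M X V) :=
  (Subcomplex.mapπ_sup _ _ _).symm

/-- `π(C(U)) ⊔ π(C(V)) ≤ π(C(U ∪ V))`. [folklore] -/
lemma relSub_sup_le (U V : Set X) : relSub R M A U ⊔ relSub R M A V ≤ relSub R M A (U ∪ V) :=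
  sup_le (relSub_mono R M Set.subset_union_left) (relSub_mono R M Set.subset_union_right)

/-- **The relative small-chains isomorphism**: for `U`, `V` open with `A ⊆ U`, the inclusion
`π(C(U)) + π(C(V)) ↪ π(C(U ∪ V))` induces isomorphisms on homology (Hatcher 2002, Prop. 2.21 and
the five-lemma, §2.2 p. 152). [cite: HatcherAT2002, §2.2 p. 152] -/
theorem isIso_homologyMap_incl_relSub_sup {U V : Set X} (hA : A ⊆ U) (hU : IsOpen U) (hV : IsOpen V)
    (q : ℕ) :
    IsIso (HomologicalComplex.homologyMap (Subcomplex.incl (relSub_sup_le R M (A := A) U V)) q) := by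
  have hle : chainsInSub R M X A ≤ chainsInSub R M X U ⊔ chainsInSub R M X V :=
    (chainsInSub_mono R M hA).trans le_sup_left
  have h1 := Subcomplex.isIso_homologyMap_incl_mapπ hle (chainsInSub_sup_le R M U V)
    (fun j => isIso_homologyMap_incl_sup R M hU hV j) q
  haveI := Subcomplex.isIso_incl_of_eq (relSub_sup R M (A := A) U V)
  rw [show Subcomplex.incl (relSub_sup_le R M (A := A) U V) =
      Subcomplex.incl (relSub_sup R M (A := A) U V).le ≫
        Subcomplex.incl (Subcomplex.mapπ_mono _ (chainsInSub_sup_le R M U V)) from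
    (Subcomplex.incl_comp_incl _ _).symm, HomologicalComplex.homologyMap_comp]
  haveI := h1
  infer_instance

variable (A) (U V : Set X)

/-! #### The maps -/

/-- **`H_q(U ∩ V, A) → H_q(U, A) × H_q(V, A)`, `x ↦ (x, x)`** (Hatcher 2002, §2.2 p. 152).
[cite: HatcherAT2002, §2.2 p. 152] -/
def hIn (q : ℕ) : (relSub R M A (U ∩ V)).toComplex.homology q →ₗ[R]
    (relSub R M A U).toComplex.homology q × (relSub R M A V).toComplex.homology q :=
  LinearMap.prod
    (HomologicalComplex.homologyMap (Subcomplex.incl (relSub_mono R M (A := A) Set.inter_subset_left)) q).hom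
    (HomologicalComplex.homologyMap (Subcomplex.incl (relSub_mono R M (A := A) Set.inter_subset_right)) q).hom

/-- **`H_q(U, A) × H_q(V, A) → H_q(U ∪ V, A)`, `(y, z) ↦ y - z`** (Hatcher 2002, §2.2 p. 152).
[cite: HatcherAT2002, §2.2 p. 152] -/
def hDiff (q : ℕ) : (relSub R M A U).toComplex.homology q × (relSub R M A V).toComplex.homology q →ₗ[R]
    (relSub R M A (U ∪ V)).toComplex.homology q :=
  (HomologicalComplex.homologyMap (Subcomplex.incl (relSub_mono R M (A := A) Set.subset_union_left)) q).hom ∘ₗ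
      LinearMap.fst R _ _ -
    (HomologicalComplex.homologyMap (Subcomplex.incl (relSub_mono R M (A := A) Set.subset_union_right)) q).hom ∘ₗ
      LinearMap.snd R _ _

variable {A U V}

/-- `hIn` unfolded. [folklore] -/
@[simp] lemma hIn_apply (q : ℕ) (x : (relSub R M A (U ∩ V)).toComplex.homology q) :
    hIn R M A U V q x =
      (HomologicalComplex.homologyMap (Subcomplex.incl (relSub_mono R M (A := A) Set.inter_subset_left)) q x,
        HomologicalComplex.homologyMap (Subcomplex.incl (relSub_mono R M (A := A) Set.inter_subset_right)) q x) :=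
  rfl

/-- `hDiff` unfolded. [folklore] -/
@[simp] lemma hDiff_apply (q : ℕ) (y : (relSub R M A U).toComplex.homology q)
    (z : (relSub R M A V).toComplex.homology q) :
    hDiff R M A U V q (y, z) =
      HomologicalComplex.homologyMap (Subcomplex.incl (relSub_mono R M (A := A) Set.subset_union_left)) q y -
        HomologicalComplex.homologyMap (Subcomplex.incl (relSub_mono R M (A := A) Set.subset_union_right)) q z :=
  rfl

/-- The identification `H_q(π(C(U)) + π(C(V))) ≃ H_q(π(C(U ∪ V)))` for `U`, `V` open, `A ⊆ U`.
[cite: HatcherAT2002, §2.2 p. 152] -/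
def supEquiv (hA : A ⊆ U) (hU : IsOpen U) (hV : IsOpen V) (q : ℕ) :
    (relSub R M A U ⊔ relSub R M A V).toComplex.homology q ≃ₗ[R]
      (relSub R M A (U ∪ V)).toComplex.homology q :=
  haveI := isIso_homologyMap_incl_relSub_sup R M hA hU hV (V := V) q
  (asIso (HomologicalComplex.homologyMap (Subcomplex.incl (relSub_sup_le R M (A := A) U V)) q)).toLinearEquiv

/-- `supEquiv` unfolded. [folklore] -/
lemma supEquiv_apply (hA : A ⊆ U) (hU : IsOpen U) (hV : IsOpen V) (q : ℕ) (x) :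
    supEquiv R M hA hU hV q x =
      HomologicalComplex.homologyMap (Subcomplex.incl (relSub_sup_le R M (A := A) U V)) q x :=
  rfl

/-- The identification `H_q(π(C(U)) ⊓ π(C(V))) ≃ H_q(π(C(U ∩ V)))` for `A ⊆ U` (an equality of
subcomplexes, `relSub_inter`). [folklore] -/
def infEquiv (hA : A ⊆ U) (V : Set X) (q : ℕ) :
    (relSub R M A U ⊓ relSub R M A V).toComplex.homology q ≃ₗ[R]
      (relSub R M A (U ∩ V)).toComplex.homology q :=
  (Subcomplex.homologyIsoOfEq (relSub_inter R M hA V).symm q).toLinearEquiv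

/-- `infEquiv` unfolded. [folklore] -/
lemma infEquiv_apply (hA : A ⊆ U) (V : Set X) (q : ℕ) (x) :
    infEquiv R M hA V q x =
      HomologicalComplex.homologyMap (Subcomplex.incl (relSub_inter R M hA V).symm.le) q x :=
  rfl

/-- **The relative Mayer–Vietoris boundary `∂ : H_{q+1}(U ∪ V, A) → H_q(U ∩ V, A)`** for open
`U`, `V` with `A ⊆ U` (Hatcher 2002, §2.2 p. 152): the connecting map of
`0 → π(C(U)) ⊓ π(C(V)) → π(C(U)) ⊞ π(C(V)) → π(C(U)) + π(C(V)) → 0` transported along the two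
identifications. [cite: HatcherAT2002, §2.2 p. 152] -/
def hδ (hA : A ⊆ U) (hU : IsOpen U) (hV : IsOpen V) (q : ℕ) :
    (relSub R M A (U ∪ V)).toComplex.homology (q + 1) →ₗ[R]
      (relSub R M A (U ∩ V)).toComplex.homology q :=
  (infEquiv R M hA V q).toLinearMap ∘ₗ
    ((Subcomplex.mvSub_shortExact (relSub R M A U) (relSub R M A V)).δ (q + 1) q rfl).hom ∘ₗ
      (supEquiv R M hA hU hV (q + 1)).symm.toLinearMap

/-! #### Exactness -/

/-- First square of the identification ladder: `hIn ∘ infEquiv = (H(fst), H(snd)) ∘ H(mvSubF)`.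
[folklore] -/
lemma hIn_comp_infEquiv (hA : A ⊆ U) (q : ℕ) :
    hIn R M A U V q ∘ₗ (infEquiv R M hA V q).toLinearMap =
      (homologyBiprodEquivProd (relSub R M A U).toComplex (relSub R M A V).toComplex q).toLinearMap ∘ₗ
        (HomologicalComplex.homologyMap
          (Subcomplex.mvSubF (relSub R M A U) (relSub R M A V)) q).hom := by
  apply LinearMap.ext
  intro x
  simp only [LinearMap.comp_apply, LinearEquiv.coe_toLinearMap]
  rw [infEquiv_apply, hIn_apply, homologyBiprodEquivProd_apply]
  congr 1
  · rw [← ModuleCat.comp_apply, ← ModuleCat.comp_apply, ← HomologicalComplex.homologyMap_comp,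
      ← HomologicalComplex.homologyMap_comp, Subcomplex.incl_comp_incl, biprod.lift_fst]
  · rw [← ModuleCat.comp_apply, ← ModuleCat.comp_apply, ← HomologicalComplex.homologyMap_comp,
      ← HomologicalComplex.homologyMap_comp, Subcomplex.incl_comp_incl, biprod.lift_snd]

/-- Second square: `hDiff ∘ (H(fst), H(snd)) = supEquiv ∘ H(mvSubG)`. [folklore] -/
lemma hDiff_comp_homologyBiprodEquivProd (hA : A ⊆ U) (hU : IsOpen U) (hV : IsOpen V) (q : ℕ) :
    hDiff R M A U V q ∘ₗ
        (homologyBiprodEquivProd (relSub R M A U).toComplex (relSub R M A V).toComplex q).toLinearMap =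
      (supEquiv R M hA hU hV q).toLinearMap ∘ₗ
        (HomologicalComplex.homologyMap
          (Subcomplex.mvSubG (relSub R M A U) (relSub R M A V)) q).hom := by
  apply LinearMap.ext
  intro w
  simp only [LinearMap.comp_apply, LinearEquiv.coe_toLinearMap]
  rw [homologyBiprodEquivProd_apply, hDiff_apply, supEquiv_apply]
  set a := HomologicalComplex.homologyMap (biprod.fst : _ ⟶ (relSub R M A U).toComplex) q w with ha
  set b := HomologicalComplex.homologyMap (biprod.snd : _ ⟶ (relSub R M A V).toComplex) q w with hb
  have hw : w = HomologicalComplex.homologyMap (biprod.inl : (relSub R M A U).toComplex ⟶ _) q a +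
      HomologicalComplex.homologyMap (biprod.inr : (relSub R M A V).toComplex ⟶ _) q b :=
    (homologyBiprod_decomp _ _ q w).symm
  rw [hw, map_add, map_add]
  have e1 : HomologicalComplex.homologyMap (Subcomplex.incl (relSub_sup_le R M (A := A) U V)) q
      (HomologicalComplex.homologyMap (Subcomplex.mvSubG (relSub R M A U) (relSub R M A V)) q
        (HomologicalComplex.homologyMap (biprod.inl : (relSub R M A U).toComplex ⟶ _) q a)) =
      HomologicalComplex.homologyMap (Subcomplex.incl (relSub_mono R M (A := A) Set.subset_union_left)) q a := by
    rw [← ModuleCat.comp_apply, ← ModuleCat.comp_apply, ← HomologicalComplex.homologyMap_comp,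
      ← HomologicalComplex.homologyMap_comp, biprod.inl_desc_assoc, Subcomplex.incl_comp_incl]
  have e2 : HomologicalComplex.homologyMap (Subcomplex.incl (relSub_sup_le R M (A := A) U V)) q
      (HomologicalComplex.homologyMap (Subcomplex.mvSubG (relSub R M A U) (relSub R M A V)) q
        (HomologicalComplex.homologyMap (biprod.inr : (relSub R M A V).toComplex ⟶ _) q b)) =
      -HomologicalComplex.homologyMap (Subcomplex.incl (relSub_mono R M (A := A) Set.subset_union_right)) q b := by
    rw [← ModuleCat.comp_apply, ← ModuleCat.comp_apply, ← HomologicalComplex.homologyMap_comp,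
      ← HomologicalComplex.homologyMap_comp, biprod.inr_desc_assoc, Preadditive.neg_comp,
      Subcomplex.incl_comp_incl, HomologicalComplex.homologyMap_neg]
    rfl
  rw [e1, e2, sub_eq_add_neg]

/-- Third square: `hδ ∘ supEquiv = infEquiv ∘ δ`. [folklore] -/
lemma hδ_comp_supEquiv (hA : A ⊆ U) (hU : IsOpen U) (hV : IsOpen V) (q : ℕ) :
    hδ R M hA hU hV q ∘ₗ (supEquiv R M hA hU hV (q + 1)).toLinearMap =
      (infEquiv R M hA V q).toLinearMap ∘ₗ
        ((Subcomplex.mvSub_shortExact (relSub R M A U) (relSub R M A V)).δ (q + 1) q rfl).hom := by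
  apply LinearMap.ext
  intro w
  change infEquiv R M hA V q ((Subcomplex.mvSub_shortExact (relSub R M A U) (relSub R M A V)).δ
    (q + 1) q rfl ((supEquiv R M hA hU hV (q + 1)).symm (supEquiv R M hA hU hV (q + 1) w))) = _
  rw [LinearEquiv.symm_apply_apply]
  rfl

/-- **Exactness at `H_q(U, A) × H_q(V, A)`** (Hatcher 2002, §2.2 p. 152).
[cite: HatcherAT2002, §2.2 p. 152] -/
theorem h_exact₂ (hA : A ⊆ U) (hU : IsOpen U) (hV : IsOpen V) (q : ℕ) :
    Function.Exact (hIn R M A U V q) (hDiff R M A U V q) := by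
  have h := (ShortComplex.ShortExact.moduleCat_exact_iff_function_exact _).mp
    ((Subcomplex.mvSub_shortExact (relSub R M A U) (relSub R M A V)).homology_exact₂ q)
  exact Function.Exact.of_ladder_linearEquiv_of_exact (hIn_comp_infEquiv R M hA q)
    (hDiff_comp_homologyBiprodEquivProd R M hA hU hV q) h

/-- **Exactness at `H_{q+1}(U ∪ V, A)`** (Hatcher 2002, §2.2 p. 152).
[cite: HatcherAT2002, §2.2 p. 152] -/
theorem h_exact₃ (hA : A ⊆ U) (hU : IsOpen U) (hV : IsOpen V) (q : ℕ) :
    Function.Exact (hDiff R M A U V (q + 1)) (hδ R M hA hU hV q) := by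
  have h := (ShortComplex.ShortExact.moduleCat_exact_iff_function_exact _).mp
    ((Subcomplex.mvSub_shortExact (relSub R M A U) (relSub R M A V)).homology_exact₃ (q + 1) q rfl)
  exact Function.Exact.of_ladder_linearEquiv_of_exact
    (hDiff_comp_homologyBiprodEquivProd R M hA hU hV (q + 1)) (hδ_comp_supEquiv R M hA hU hV q) h

/-- **Exactness at `H_q(U ∩ V, A)`** (Hatcher 2002, §2.2 p. 152). [cite: HatcherAT2002, §2.2 p. 152] -/
theorem h_exact₁ (hA : A ⊆ U) (hU : IsOpen U) (hV : IsOpen V) (q : ℕ) :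
    Function.Exact (hδ R M hA hU hV q) (hIn R M A U V q) := by
  have h := (ShortComplex.ShortExact.moduleCat_exact_iff_function_exact _).mp
    ((Subcomplex.mvSub_shortExact (relSub R M A U) (relSub R M A V)).homology_exact₁ (q + 1) q rfl)
  exact Function.Exact.of_ladder_linearEquiv_of_exact (hδ_comp_supEquiv R M hA hU hV q)
    (hIn_comp_infEquiv R M hA q) h

/-- **`hDiff` is onto `H₀(U ∪ V, A)`**: the sequence ends with `H₀(U, A) ⊕ H₀(V, A) → H₀(U ∪ V, A) → 0`
(Hatcher 2002, §2.2 p. 152). [cite: HatcherAT2002, §2.2 p. 152] -/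
theorem hDiff_zero_surjective (hA : A ⊆ U) (hU : IsOpen U) (hV : IsOpen V) :
    Function.Surjective (hDiff R M A U V 0) := by
  intro x
  obtain ⟨w, rfl⟩ := (supEquiv R M hA hU hV 0).surjective x
  haveI : Epi ((Subcomplex.mvSub (relSub R M A U) (relSub R M A V)).g.f 0) :=
    (ModuleCat.epi_iff_surjective _).mpr (Subcomplex.mvSubG_surjective _ _ 0)
  have hepi : Epi (HomologicalComplex.homologyMap
      (Subcomplex.mvSub (relSub R M A U) (relSub R M A V)).g 0) :=
    HomologicalComplex.epi_homologyMap_of_epi_of_not_rel _ 0 (fun j h => by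
      change j + 1 = 0 at h; omega)
  obtain ⟨y, rfl⟩ := (ModuleCat.epi_iff_surjective _).mp hepi w
  refine ⟨homologyBiprodEquivProd _ _ 0 y, ?_⟩
  have e := congrArg (fun f => f y) (hDiff_comp_homologyBiprodEquivProd R M hA hU hV 0)
  exact e

/-- **Generation in one degree from vanishing one degree below**: if `H_q(U ∩ V, A) = 0` then every
class of `H_{q+1}(U ∪ V, A)` is `y|^{U ∪ V} - z|^{U ∪ V}` for classes `y ∈ H_{q+1}(U, A)`,
`z ∈ H_{q+1}(V, A)` (exactness at `H_{q+1}(U ∪ V, A)`; Hatcher 2002, §2.2 p. 152).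
[cite: HatcherAT2002, §2.2 p. 152] -/
theorem hDiff_surjective_of_subsingleton (hA : A ⊆ U) (hU : IsOpen U) (hV : IsOpen V) (q : ℕ)
    (h0 : Subsingleton ((relSub R M A (U ∩ V)).toComplex.homology q)) :
    Function.Surjective (hDiff R M A U V (q + 1)) := by
  intro x
  have hx : hδ R M hA hU hV q x = 0 := Subsingleton.elim _ _
  exact (h_exact₃ R M hA hU hV q x).mp hx

/-- The same with the vanishing hypothesis in the form `IsZero`. [cite: HatcherAT2002, §2.2 p. 152] -/
theorem hDiff_surjective_of_isZero (hA : A ⊆ U) (hU : IsOpen U) (hV : IsOpen V) (q : ℕ)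
    (h0 : IsZero ((relSub R M A (U ∩ V)).toComplex.homology q)) :
    Function.Surjective (hDiff R M A U V (q + 1)) :=
  hDiff_surjective_of_subsingleton R M hA hU hV q (ModuleCat.subsingleton_of_isZero h0)

end relOpenMV

end Literature.AlgebraicTopology.SingularHomology
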